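import Summits.CriticalPhenomena.Ising3DConformalLimit.Theses.PerfectScreening
import Summits.CriticalPhenomena.Ising3DConformalLimit.Theses.EnergyNotSigmaSquared
import Summits.CriticalPhenomena.Ising3DConformalLimit.Theses.HyperoctahedralRP
import Summits.CriticalPhenomena.Ising3DConformalLimit.Theses.PositivityBegetsConformality
import Summits.CriticalPhenomena.Ising3DConformalLimit.Theorems.MoebiusLimitExists.Negative.DeltaWindow
import Summits.CriticalPhenomena.Ising3DConformalLimit.Theorems.MoebiusLimitExists.Negative.EtaExists
import Literature.Probability.LatticeModels.CriticalScalingDimension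

/-!
# Line `one-map-one-jet` for crux `MoebiusLimitExists` (stmt-CriticalPhenomena-1344)

Crux (by name): `Theses.PerfectScreening.MoebiusLimitExists` = `Theses.EnergyNotSigmaSquared.MoebiusLimit`
(same term; primary route `route-CriticalPhenomena-EnergyNotSigmaSquared`, shared by PerfectScreening,
AnomalousForcesInteraction, GammaForcesInteraction):

  `∃ ρ Δ S, (∀ δ ∈ (0,1], 0 < ρ δ) ∧ 0 < Δ ∧ HasPointwiseScalingLimit (criticalCorr 3) ρ S ∧
     IsNondegenerateTwoPoint S ∧ IsMoebiusCovariant Δ S`.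

Skeleton (crux-plan, planner-cruxplan-stmt-CriticalPhenomena-1344-one-map-one-jet-0, 2026-08-15) of idea
card `Ideas/one-map-one-jet.md` (ideator k = 2; triage r1-1/r1-2/r1-3: pass) with the panel's sharpenings:
(a) `0 < Δ` carried by every "limit" stub; (b) the residual is named honestly — inversion covariance of the
ANALYTIC limit, in germ form at one configuration per `n` — and is ONE stub, not "jet" and "clause (ii)"
separately; (c) continuity of the limit on `NonCoincident` is made an explicit provable stub (mesh continuity)
instead of a silent assumption; (d) analyticity is only claimed on the GOOD configurations of the nine-mirror
(`B₃`) arrangement, never on all of `NonCoincident` and never at a diagonal, and the codimension-2 exceptional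
set is handled by connectedness + density (a geometry stub), not by an extension claim.

THE LINE. Take the witness `(ρ, Δ, S)` of the shared existence item stmt-CriticalPhenomena-1981
(`HyperoctahedralRP.ExistsScaleCovariantLimit`: pointwise limit, normalised off `NonCoincident`,
non-degenerate, translation invariant, scale covariant — NO rotations), which enters BY NAME. Then:
* `stub_meshContinuity` (M, provable now, model-independent): a translation-invariant locally uniform
  limit of mesh-`δ` cell functions as `δ → 0⁺` is continuous off the diagonals.
* `stub_nineMirrorAnalyticity` (L, the enabling theorem): reflection positivity of `criticalCorr 3` in the
  nine lattice mirrors `e_i`, `e_i ± e_j` passes to the limit; Osterwalder–Schrader contraction semigroups in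
  each of the nine directions give holomorphic extension in that direction's ordered gaps; at a configuration
  whose projections are injective along three INDEPENDENT mirror normals (`GoodConfig n`) the separate
  analyticities cross (Bernstein–Siciak / Jarnicki–Pflug, uniform complex radii from the semigroup) to joint
  real-analyticity of `S n`.
* `stub_goodConfigGeometry` (M): the set `InvGoodConfig n` of punctured configurations `x` with `x` and
  `ι x` both good is preconnected and dense in the punctured non-coincident configurations (at most four of
  the nine normals are coplanar ⇒ the bad set lies in finitely many codimension ≥ 2 linear subspaces and
  their `ι`-images; complements of codimension-2 sets in `(ℝ³)ⁿ` stay connected).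
* `stub_onePointJetReduction` (M): for a normalised family continuous off diagonals and analytic on the good
  set, vanishing of the GERM of the inversion defect `D_n = S_n ∘ ι − (∏‖x_i‖^{2Δ}) S_n` at ONE point of
  `InvGoodConfig n` (per `n`) is full `IsInversionCovariant Δ S` (identity theorem on the preconnected set,
  density + continuity at bad points, normalisation at coincident ones; `ι` is only used off the origin).
* `stub_inversionGermOfAnalyticLimit` (open, HARDEST — the residual crux, honestly named): for every such
  analytic limit of the critical `ℤ³` correlators and every `n` the inversion germ vanishes at some good
  configuration. Order 0 is free on the fixed unit sphere of `ι` (`inversionDefect_eq_zero_of_norm_eq_one`,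
  proved below); order 1 there is the equal-radial-weights law `(x_i·∇_i + Δ) S_n = 0` spin by spin, which at
  `n = 4` on all spheres already is Möbius covariance of `S₄` (rank 7 → 10, triage job j007003 CHECK_B).
* `MoebiusLimitExists_of : ExistsScaleCovariantLimit → InversionBegetsRotations → MoebiusLimitExists`: existence
  (1981) + the group lemma stmt-CriticalPhenomena-4675 (`PositivityBegetsConformality.InversionBegetsRotations`:
  translations + inversion ⇒ `O(3)`, so NO rotation stub), both BY NAME, composed with the five registered stubs ⇒
  the crux, by name; the logic is certified sorry-free by `cruxBody_of_statements` (stub statements as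
  hypotheses, conclusion = the crux's definiens); `MoebiusLimit_of` is the primary route's spelling.

Disproof.lean (cdisprove gen 2, verdict "resists") honoured: `cruxWithoutLimit_holds` — the lattice limit is
load-bearing, and it is used twice (analyticity comes from RP OF `criticalCorr 3`; the residual quantifies over
limits of `criticalCorr 3` only, so it is not an instance of the refuted model-blind upgrades
`not_euclideanScaleUpgrade` / the triage's DSI-Gaussian-mixture negative); `crux_iff_normalised` — every stub
carries `S = 0` off `NonCoincident`; `not_cruxWithInversionAtOrigin` — the germ point has all `x_i ≠ 0` and
the conclusion is the tree predicate `IsInversionCovariant` (off the origin); `not_cruxWithContinuousTwoPoint`,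
`not_cruxWithLimitAtDiagonal`, `not_cruxWithUniformLimit` — continuity / analyticity / convergence are asserted
on `NonCoincident` / `GoodConfig` only; `witness_delta_mem_Icc`, `not_cruxWithBoundedRho`, landed
`Negative/DeltaWindow`, `Negative/EtaExists` (imported here), `Negative/ScaleFree` — no stub fixes `Δ`, bounds
`ρ`, or contradicts `Δ ∈ [1/2, 3/4]`; no `_false_without_` theorem exists yet. `ledger negatives --problem
CriticalPhenomena`: nothing in this sub-problem.
-/

noncomputable section

namespace Summit.CriticalPhenomena.Ising3DConformalLimit.Cruxes.MoebiusLimitExists.OneMapOneJet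

open Literature.Probability.LatticeModels EuclideanGeometry Filter Set
open scoped Topology

set_option linter.unusedVariables false

/-! ## Objects of the line -/

/-- Points of `ℝ³`. -/
abbrev E3 : Type := EuclideanSpace ℝ (Fin 3)

/-- The unit inversion `ι` applied to every point of a configuration. -/
def invCfg {n : ℕ} (x : Fin n → E3) : Fin n → E3 := fun i => inversion 0 1 (x i)

/-- The inversion defect `D_n(x) = S n (ι x) − (∏ ‖x i‖^{2Δ}) · S n x`; `IsInversionCovariant Δ S` says
`D_n = 0` at every configuration avoiding the origin. -/
def inversionDefect (Δ : ℝ) (S : CorrFamily 3) (n : ℕ) (x : Fin n → E3) : ℝ :=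
  S n (invCfg x) - (∏ i, ‖x i‖ ^ (2 * Δ)) * S n x

/-- Non-coincident configurations avoiding the pole `0` of `ι`. -/
def PuncturedNonCoincident (n : ℕ) : Set (Fin n → E3) :=
  {x | x ∈ NonCoincident 3 n ∧ ∀ i, x i ≠ 0}

/-- The nine lattice mirror normals `e_i`, `e_i + e_j`, `e_i − e_j` (`i ≠ j`): the `B₃` arrangement, exactly
the normals of `HyperoctahedralRP.HRP2Rigidity` / `CriticalCorrNineMirrorRP`. -/
def mirrorNormals : Set E3 :=
  {v | ∃ i j : Fin 3, i ≠ j ∧ (v = EuclideanSpace.single i 1 ∨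
      v = EuclideanSpace.single i 1 + EuclideanSpace.single j 1 ∨
      v = EuclideanSpace.single i 1 - EuclideanSpace.single j 1)}

/-- GOOD configurations: non-coincident, and there are three linearly independent mirror normals along each
of which the `n` projections `i ↦ ⟪x i, v⟫` are pairwise distinct (three independent OS "time" directions). -/
def GoodConfig (n : ℕ) : Set (Fin n → E3) :=
  {x | x ∈ NonCoincident 3 n ∧ ∃ v : Fin 3 → E3, LinearIndependent ℝ v ∧ (∀ a, v a ∈ mirrorNormals) ∧
      ∀ a, Function.Injective (fun i => inner ℝ (x i) (v a))}

/-- The analyticity domain of the inversion defect: punctured configurations `x` with `x` AND `ι x` good. -/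
def InvGoodConfig (n : ℕ) : Set (Fin n → E3) :=
  {x | (∀ i, x i ≠ 0) ∧ x ∈ GoodConfig n ∧ invCfg x ∈ GoodConfig n}

/-- ORDER 0 IS FREE: on the fixed unit sphere of `ι` the inversion defect vanishes identically (`ι x = x`,
all weights `1`). So the germ condition of `stub_inversionGermOfAnalyticLimit` at a cospherical point starts
at order 1, where it reads `(x_i·∇_i + Δ) S_n = 0` for each `i` (equal radial weights). [folklore] -/
theorem inversionDefect_eq_zero_of_norm_eq_one (Δ : ℝ) (S : CorrFamily 3) {n : ℕ} {x : Fin n → E3}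
    (hx : ∀ i, ‖x i‖ = 1) : inversionDefect Δ S n x = 0 := by
  have h1 : invCfg x = x := by
    funext i
    exact inversion_of_mem_sphere (by simp [hx i])
  have h2 : (∏ i, ‖x i‖ ^ (2 * Δ)) = 1 := by
    simp [hx]
  simp [inversionDefect, h1, h2]

/-! ## Registered stubs -/

/-- **Stub 1 — mesh continuity (M, provable now, model-independent).** A locally uniform limit, as the mesh
`δ → 0⁺` runs through ALL small positive reals, of functions constant on the cells of the `δ`-grid
(`rescaledCorrelator G ρ n δ = ρ(δ)^n · G n (⌊·/δ⌋)`) which is translation invariant is continuous on the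
non-coincident configurations. Why true: translate the pair `x, y` (common vector `v`, `S` is invariant, the
limit clause holds at the translated points too) so that all coordinates are `≥ δ₀`; for `δ` ranging over
`[δ₀/2, δ₀)` the residues `x_k/δ mod 1` sweep, and the set of `δ` for which some coordinate interval
`[x_k, y_k]` (length `< η`) contains a multiple of `δ` has measure `≤ 3·(3n)·η`; for `η < δ₀/(18 n)` some `δ`
puts `x` and `y` in a common cell, where the cell function takes ONE value `ε`-close to both `S x` and `S y`.
(Translation invariance is needed: `𝟙{x₁₁ ≥ 0}` is a cell function for every `δ`.) Feeds stubs 2, 4, 5. -/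
theorem stub_meshContinuity :
    ∀ (G : LatticeCorrFamily 3) (ρ : ℝ → ℝ) (S : CorrFamily 3),
      HasPointwiseScalingLimit G ρ S → IsTranslationInvariant S →
      ∀ n, ContinuousOn (S n) (NonCoincident 3 n) := by
  sorry

/-- **Stub 2 — nine-mirror analyticity (L, the enabling theorem).** Every normalised, non-degenerate,
translation-invariant, scale-covariant (`0 < Δ`) pointwise scaling limit of the critical `ℤ³` correlators
that is continuous off the diagonals is jointly real-analytic on the good configurations. Why true: lattice
reflection positivity in each of the nine mirrors (tree `isingMeasure_univ_free_reflectionPositive`, FILS 1978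
§3 Thm 3.1; route item `HyperoctahedralRP.CriticalCorrNineMirrorRP`) is a closed condition and passes to the
limit on configurations off the mirror; with translation invariance it gives an Osterwalder–Schrader
contraction semigroup in each mirror direction `v` (sharp-point insertions are OS vectors, norm² = `S_{2k}` at
the reflected doubled configuration, finite off the mirror), hence holomorphy of `S n` in the ordered gaps of
the projections `⟪x i, v⟫` whenever these are pairwise distinct, with locally uniform bounds; at `x ∈
GoodConfig n` three such directions are linearly independent, i.e. `S n` is separately real-analytic in three
groups of coordinates spanning `(ℝ³)ⁿ` with uniform complex radii, hence jointly real-analytic by the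
cross theorem (Bernstein–Siciak; Jarnicki–Pflug 2011). Uses the lattice clause (RP OF `criticalCorr 3`). -/
theorem stub_nineMirrorAnalyticity :
    ∀ (ρ : ℝ → ℝ) (Δ : ℝ) (S : CorrFamily 3), (∀ δ ∈ Set.Ioc (0:ℝ) 1, 0 < ρ δ) → 0 < Δ →
      HasPointwiseScalingLimit (criticalCorr 3) ρ S →
      (∀ n z, z ∉ NonCoincident 3 n → S n z = 0) → IsNondegenerateTwoPoint S →
      IsTranslationInvariant S → IsScaleCovariant Δ S →
      (∀ n, ContinuousOn (S n) (NonCoincident 3 n)) →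
      ∀ n, AnalyticOnNhd ℝ (S n) (GoodConfig n) := by
  sorry

/-- **Stub 3 — geometry of the good set (M).** For every `n`, the punctured doubly-good configurations form a
preconnected set which is dense in the punctured non-coincident configurations. Why true: no two of the nine
normals are parallel and at most four are coplanar, so a configuration is bad only if ≥ 5 normals are each
orthogonal to some difference `x i − x j`, which places it in a finite union of linear subspaces of
codimension ≥ 2 of `(ℝ³)ⁿ`; `ι` is a real-analytic involutive diffeomorphism of the punctured configurations,
so the `ι`-image of the bad set is again a finite union of codimension ≥ 2 submanifolds; the punctured
non-coincident set is `(ℝ³)ⁿ` minus finitely many codimension-3 subspaces (connected, open), and removing a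
closed subset of finitely many codimension ≥ 2 submanifolds keeps it connected and dense. -/
theorem stub_goodConfigGeometry :
    ∀ n, IsPreconnected (InvGoodConfig n) ∧ PuncturedNonCoincident n ⊆ closure (InvGoodConfig n) := by
  sorry

/-- **Stub 4 — one-point jet reduction (M, provable now).** For a family normalised off `NonCoincident`,
continuous on it and real-analytic on the good configurations: if for every `n` the inversion defect has
vanishing germ at ONE point of the (preconnected, dense) set `InvGoodConfig n`, the family is inversion
covariant. Why true: `D_n` is real-analytic on `InvGoodConfig n` (`S n` analytic at `x` and at `ι x`, `ι`
analytic off `0`, `t ↦ t^{2Δ}` analytic on `t > 0`), so the identity theorem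
(`AnalyticOnNhd.eqOn_zero_of_preconnected_of_eventuallyEq_zero`) gives `D_n = 0` there; `D_n` is continuous
on the punctured non-coincident set, which lies in the closure, so `D_n = 0` on it; at a punctured coincident
`x` both `S n x` and `S n (ι x)` vanish by normalisation (`ι` is injective off `0`). This is exactly the tree
predicate `IsInversionCovariant` (inversion off the origin only, `not_cruxWithInversionAtOrigin`). -/
theorem stub_onePointJetReduction :
    ∀ (Δ : ℝ) (S : CorrFamily 3),
      (∀ n z, z ∉ NonCoincident 3 n → S n z = 0) →
      (∀ n, ContinuousOn (S n) (NonCoincident 3 n)) →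
      (∀ n, AnalyticOnNhd ℝ (S n) (GoodConfig n)) →
      (∀ n, IsPreconnected (InvGoodConfig n)) →
      (∀ n, PuncturedNonCoincident n ⊆ closure (InvGoodConfig n)) →
      (∀ n, ∃ x₀ ∈ InvGoodConfig n, inversionDefect Δ S n =ᶠ[𝓝 x₀] 0) →
      IsInversionCovariant Δ S := by
  sorry

/-- **Stub 5 — inversion germ of the analytic limit (open; HARDEST; the residual crux, honestly named).**
For every normalised, non-degenerate, translation-invariant, scale-covariant (`0 < Δ`) pointwise scaling
limit of the critical `ℤ³` correlators that is continuous off the diagonals and real-analytic on the good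
configurations, and every `n`, the inversion defect has vanishing germ at SOME doubly-good punctured
configuration (prover's choice). By stubs 3–4 this is EQUIVALENT to inversion covariance of that limit — it is
clause (ii) of the crux minus rotations (which follow, item 4675) for the analytic limit, re-cut locally: at a
point of the fixed unit sphere order 0 is free (`inversionDefect_eq_zero_of_norm_eq_one`), order 1 is the
equal-radial-weights law `(x_i·∇_i + Δ) S_n (x) = 0` for EACH `i` (sum over `i` = the scale Ward identity),
which at `n = 4`, asked on all spheres, is already Möbius covariance of `S₄` (rank 7 → 10); higher orders /
`n ≥ 5` carry no mechanism yet. NOT claimed to follow from RP + Euclid + scale (false without clustering /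
lattice provenance: phase-averaged DSI generalised free field, TRIAGE r1-2/r1-3); the hypothesis
`HasPointwiseScalingLimit (criticalCorr 3) ρ S` is load-bearing (`cruxWithoutLimit_holds`). Why it might be
provable at all: the lattice avatar of order 1 is a single-spin radial-displacement law for sourced random
currents on lattice spheres (`u_c(1 ∓ Δ/R)`, integrated form), and `n = 4` reduces to radial stationarity of
Aizenman's intersection probability about the circumcentre. -/
theorem stub_inversionGermOfAnalyticLimit :
    ∀ (ρ : ℝ → ℝ) (Δ : ℝ) (S : CorrFamily 3), (∀ δ ∈ Set.Ioc (0:ℝ) 1, 0 < ρ δ) → 0 < Δ →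
      HasPointwiseScalingLimit (criticalCorr 3) ρ S →
      (∀ n z, z ∉ NonCoincident 3 n → S n z = 0) → IsNondegenerateTwoPoint S →
      IsTranslationInvariant S → IsScaleCovariant Δ S →
      (∀ n, ContinuousOn (S n) (NonCoincident 3 n)) →
      (∀ n, AnalyticOnNhd ℝ (S n) (GoodConfig n)) →
      ∀ n, ∃ x₀ ∈ InvGoodConfig n, inversionDefect Δ S n =ᶠ[𝓝 x₀] 0 := by
  sorry

/-! ## Kernel-checked composition -/

/-- **Sorry-free certificate of the composition.** With the five stub STATEMENTS as hypotheses (verbatim the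
signatures of `stub_meshContinuity`, `stub_nineMirrorAnalyticity`, `stub_goodConfigGeometry`,
`stub_onePointJetReduction`, `stub_inversionGermOfAnalyticLimit`) and the two route items by name, the
DEFINIENS of the crux (spelled out, so that this certificate is not itself a candidate skeleton theorem)
follows by pure logic. -/
theorem cruxBody_of_statements
    (hE : Theses.HyperoctahedralRP.ExistsScaleCovariantLimit)
    (hR : Theses.PositivityBegetsConformality.InversionBegetsRotations)
    (h₁ : ∀ (G : LatticeCorrFamily 3) (ρ : ℝ → ℝ) (S : CorrFamily 3),
      HasPointwiseScalingLimit G ρ S → IsTranslationInvariant S →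
      ∀ n, ContinuousOn (S n) (NonCoincident 3 n))
    (h₂ : ∀ (ρ : ℝ → ℝ) (Δ : ℝ) (S : CorrFamily 3), (∀ δ ∈ Set.Ioc (0:ℝ) 1, 0 < ρ δ) → 0 < Δ →
      HasPointwiseScalingLimit (criticalCorr 3) ρ S →
      (∀ n z, z ∉ NonCoincident 3 n → S n z = 0) → IsNondegenerateTwoPoint S →
      IsTranslationInvariant S → IsScaleCovariant Δ S →
      (∀ n, ContinuousOn (S n) (NonCoincident 3 n)) →
      ∀ n, AnalyticOnNhd ℝ (S n) (GoodConfig n))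
    (h₃ : ∀ n, IsPreconnected (InvGoodConfig n) ∧ PuncturedNonCoincident n ⊆ closure (InvGoodConfig n))
    (h₄ : ∀ (Δ : ℝ) (S : CorrFamily 3),
      (∀ n z, z ∉ NonCoincident 3 n → S n z = 0) →
      (∀ n, ContinuousOn (S n) (NonCoincident 3 n)) →
      (∀ n, AnalyticOnNhd ℝ (S n) (GoodConfig n)) →
      (∀ n, IsPreconnected (InvGoodConfig n)) →
      (∀ n, PuncturedNonCoincident n ⊆ closure (InvGoodConfig n)) →
      (∀ n, ∃ x₀ ∈ InvGoodConfig n, inversionDefect Δ S n =ᶠ[𝓝 x₀] 0) →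
      IsInversionCovariant Δ S)
    (h₅ : ∀ (ρ : ℝ → ℝ) (Δ : ℝ) (S : CorrFamily 3), (∀ δ ∈ Set.Ioc (0:ℝ) 1, 0 < ρ δ) → 0 < Δ →
      HasPointwiseScalingLimit (criticalCorr 3) ρ S →
      (∀ n z, z ∉ NonCoincident 3 n → S n z = 0) → IsNondegenerateTwoPoint S →
      IsTranslationInvariant S → IsScaleCovariant Δ S →
      (∀ n, ContinuousOn (S n) (NonCoincident 3 n)) →
      (∀ n, AnalyticOnNhd ℝ (S n) (GoodConfig n)) →
      ∀ n, ∃ x₀ ∈ InvGoodConfig n, inversionDefect Δ S n =ᶠ[𝓝 x₀] 0) :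
    ∃ (ρ : ℝ → ℝ) (Δ : ℝ) (S : CorrFamily 3), (∀ δ ∈ Set.Ioc (0:ℝ) 1, 0 < ρ δ) ∧ 0 < Δ ∧
      HasPointwiseScalingLimit (criticalCorr 3) ρ S ∧ IsNondegenerateTwoPoint S ∧
        IsMoebiusCovariant Δ S := by
  obtain ⟨ρ, Δ, S, hρ, hΔ, hlim, hnorm, hnd, htr, hsc⟩ := hE
  have hcont : ∀ n, ContinuousOn (S n) (NonCoincident 3 n) := h₁ (criticalCorr 3) ρ S hlim htr
  have han : ∀ n, AnalyticOnNhd ℝ (S n) (GoodConfig n) :=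
    h₂ ρ Δ S hρ hΔ hlim hnorm hnd htr hsc hcont
  have hgerm : ∀ n, ∃ x₀ ∈ InvGoodConfig n, inversionDefect Δ S n =ᶠ[𝓝 x₀] 0 :=
    h₅ ρ Δ S hρ hΔ hlim hnorm hnd htr hsc hcont han
  have hinv : IsInversionCovariant Δ S :=
    h₄ Δ S hnorm hcont han (fun n => (h₃ n).1) (fun n => (h₃ n).2) hgerm
  have hrot : IsRotationInvariant S := hR Δ S htr hinv
  exact ⟨ρ, Δ, S, hρ, hΔ, hlim, hnd, ⟨htr, hrot⟩, hsc, hinv⟩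

/-- **The line concludes the crux BY NAME.** Existence without rotations (item stmt-CriticalPhenomena-1981,
`HyperoctahedralRP.ExistsScaleCovariantLimit`, shared, by name) + the group lemma (item
stmt-CriticalPhenomena-4675, `PositivityBegetsConformality.InversionBegetsRotations`, provable now, by name)
+ the five registered stubs ⇒ `Theses.PerfectScreening.MoebiusLimitExists`: the certificate
`cruxBody_of_statements` applied to the stubs (the crux decl unfolds to its definiens), so the stub signatures
ARE the certificate's hypotheses, verbatim, and the only `sorry` in the closure sits inside the stubs. -/
theorem MoebiusLimitExists_of
    (hE : Theses.HyperoctahedralRP.ExistsScaleCovariantLimit)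
    (hR : Theses.PositivityBegetsConformality.InversionBegetsRotations) :
    Theses.PerfectScreening.MoebiusLimitExists :=
  cruxBody_of_statements hE hR stub_meshContinuity stub_nineMirrorAnalyticity stub_goodConfigGeometry
    stub_onePointJetReduction stub_inversionGermOfAnalyticLimit

/-- The same composition under the primary route's spelling of the crux
(`Theses.EnergyNotSigmaSquared.MoebiusLimit`, item stmt-CriticalPhenomena-1344; the two decls are the same
term). -/
theorem MoebiusLimit_of
    (hE : Theses.HyperoctahedralRP.ExistsScaleCovariantLimit)
    (hR : Theses.PositivityBegetsConformality.InversionBegetsRotations) :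
    Theses.EnergyNotSigmaSquared.MoebiusLimit :=
  MoebiusLimitExists_of hE hR

end Summit.CriticalPhenomena.Ising3DConformalLimit.Cruxes.MoebiusLimitExists.OneMapOneJet

end
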